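import Mathlib
import Literature.RingTheory.Multisymmetric.LowDegreeRank
import Summits.ValiantsHypothesis.ValiantsHypothesis.Theorems.ValuativeGCTValuativeFlipNoSmallBodyEquations
import Summits.ValiantsHypothesis.ValiantsHypothesis.Theorems.ValuativeGCTValuativeFlipSeedCriterion

/-!
# The ideal of `Det_m` is small at every weight: `a(χ) − K_m(χ) ≤ p_{> m}(body)`

Wall-breaker axis D (det-orbit-closure multiplicity bounds) for crux `ValuativeGCT.ValuativeFlip`
(stmt-ValiantsHypothesis-12624): the quantitative form of "no equations of `Det_m` of small body"
(`…NoSmallBodyEquations`).  For a weight `χ` of `k[Sym^m k^{m×m}]` and a base letter `i₀`, the BODY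
CONTENT of `χ` is `α(χ) = (-χ i)_{i ≠ i₀}` (how often each letter other than `i₀` occurs in a monomial of
weight `χ`); a highest-weight vector `F` of weight `χ` becomes, after renaming the coordinate `X_d` to the
symbol `Z_{d|_{i≠i₀}}` and deleting the symbol of the pure power `x_{i₀}^m`, a polynomial `Q_F` whose
monomials are VECTOR PARTITIONS of `α(χ)` (`Literature/RingTheory/Multisymmetric/LowDegreeRank.lean`), and
`F` vanishes on the diagonal pencils of `det_m` iff `Q_F` is a relation among the elementary multisymmetric
polynomials `e_β(t_1,…,t_m)` (`…DetDiagonalPencil`, `…SmallBodyWeightVectors`).  Since `F ↦ Q_F` is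
injective and equations of `Det_m` vanish on every pencil, the multiplicity of `χ` in the IDEAL of
`Δ(det_m)` is at most the dimension of the space of such relations, which is at most the number
`p_{> m}(α(χ))` of vector partitions of the body content with MORE than `m` parts
(`finrank_le_card_of_aeval_elemMultisymm_eq_zero`; the generic-orbit-map specialisation is the landed
`aeval_genericOrbitMap_matrix` of `…SeedCriterion`):

* `plethysmCoeff_le_orbitMultiplicity_detFormLex_add_card` — weight form, any field of characteristic
  zero, any letter: `a(χ) ≤ K_m(χ) + p_{> m}(α(χ))`;
* `plethysmCoeff_le_orbitMultiplicity_det_add_card` — partition form over `ℂ` at the top letter: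
  `a_λ(δ[m]) ≤ K_m(λ*) + p_{> m}(λ̄)`;
* `flip_forces_near_full_perSide` — crux currency: a valuative flip at `(n, m, U, r, δ, λ)` forces
  `a_λ(δ[m]) < mult_{λ*} ℂ[Δ_m(X₀₀^{m−n} per_n)] + p_{> m}(λ̄)` (with the proved `ValuativeBound`): the
  permanent side must be within `p_{> m}(λ̄)` of the FULL plethysm coefficient.  At body `|λ̄| ≤ m` the
  count is `0` (no flip, `noSmallBodyFlip`); at body `m + 1` it is `1` (only the all-singleton partition
  has `m + 1` parts), so there a flip needs `mult_pp = a_λ` exactly and a genuine equation of `Det_m`.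

No new definitions in this file; axioms standard. [new; vector partitions: MacMahon, Combinatory
Analysis II §XI]
-/

set_option linter.dupNamespace false

namespace Summit.ValiantsHypothesis.ValiantsHypothesis.Theorems.ValuativeFlip

open MvPolynomial
open scoped BigOperators Matrix
open Literature.NumberTheory.DiophantineGeometry
open Literature.Computability.AlgebraicComplexity
open Literature.Computability.Complexity
open Literature.RingTheory.Multisymmetric

noncomputable section

/-- The symbol-deleting map `Z^t ↦ Z^{t.erase 0}` on monomials. [folklore] -/
theorem constr_erase_monomial {k : Type*} [Field k] {ι : Type*} [DecidableEq ι]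
    (t : (ι →₀ ℕ) →₀ ℕ) (c : k) :
    (basisMonomials (ι →₀ ℕ) k).constr k
        (fun s : (ι →₀ ℕ) →₀ ℕ => (monomial (s.erase 0) (1 : k) : MvPolynomial (ι →₀ ℕ) k))
        (monomial t c) = monomial (t.erase 0) c := by
  classical
  rw [← mul_one c, ← smul_eq_mul, ← smul_monomial, map_smul]
  have h := (basisMonomials (ι →₀ ℕ) k).constr_basis k
    (fun s : (ι →₀ ℕ) →₀ ℕ => (monomial (s.erase 0) (1 : k) : MvPolynomial (ι →₀ ℕ) k)) t
  rw [coe_basisMonomials] at h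
  rw [h, smul_monomial, smul_eq_mul]

/-- Deleting the symbol of the zero part: the linear map `Z^s ↦ Z^{s.erase 0}` on polynomials in the
symbols `Z_β`. Evaluation at `Z_β = e_β` is unchanged (`e_0 = 1`). [folklore] -/
theorem aeval_elemMultisymm_constr_erase {k : Type*} [Field k] {ι : Type*} [Fintype ι] [DecidableEq ι]
    (n : ℕ) (P : MvPolynomial (ι →₀ ℕ) k) :
    aeval (elemMultisymm (k := k) ι n)
        ((basisMonomials (ι →₀ ℕ) k).constr k
          (fun s : (ι →₀ ℕ) →₀ ℕ => (monomial (s.erase 0) (1 : k) : MvPolynomial (ι →₀ ℕ) k)) P) =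
      aeval (elemMultisymm (k := k) ι n) P := by
  classical
  conv_rhs => rw [← support_sum_monomial_coeff P]
  conv_lhs => rw [← support_sum_monomial_coeff P, map_sum]
  rw [map_sum, map_sum]
  refine Finset.sum_congr rfl fun s _ => ?_
  rw [constr_erase_monomial, aeval_monomial, aeval_monomial]
  congr 1
  exact elemProd_erase_zero s

/-- The symbol-deleting map on the coefficients: `coeff (s.erase 0) (Θ P) = coeff s P` when all
monomials of `P` have the same degree. [folklore] -/
theorem coeff_erase_constr_erase {k : Type*} [Field k] {ι : Type*} [DecidableEq ι]
    {P : MvPolynomial (ι →₀ ℕ) k} {D : ℕ} (hD : ∀ s ∈ P.support, s.degree = D)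
    (s : (ι →₀ ℕ) →₀ ℕ) (hs : s ∈ P.support) :
    coeff (s.erase 0) ((basisMonomials (ι →₀ ℕ) k).constr k
      (fun s : (ι →₀ ℕ) →₀ ℕ => (monomial (s.erase 0) (1 : k) : MvPolynomial (ι →₀ ℕ) k)) P) =
      coeff s P := by
  classical
  conv_lhs => rw [← support_sum_monomial_coeff P, map_sum]
  simp only [constr_erase_monomial, coeff_sum, coeff_monomial]
  rw [Finset.sum_eq_single s]
  · rw [if_pos rfl]
  · intro t ht hne
    rw [if_neg]
    intro h
    exact hne (eq_of_erase_zero_eq h ((hD t ht).trans (hD s hs).symm))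
  · intro h; exact absurd hs h

/-- **The ideal of `Δ(det_m)` at a weight is bounded by vector-partition counts** (weight form, any field
of characteristic zero, any base letter `i₀`).  For every weight `χ` of `k[Sym^m k^{m×m}]`:
`mult_χ k[Sym^m] ≤ mult_χ k[Δ(det_m)] + p_{> m}(α(χ))`, where `α(χ) = (-χ i)_{i ≠ i₀}` is the body content
and `p_{> m}` counts its vector partitions with more than `m` parts.  Registered sub-goal of the crux
(wall-breaker k7, axis D). [new] -/
theorem plethysmCoeff_le_orbitMultiplicity_detFormLex_add_card {k : Type*} [Field k] [CharZero k] {m : ℕ} (i₀ : MatIdx m) (χ : Weight (MatIdx m)) : plethysmCoeff k (MatIdx m) m χ ≤ orbitMultiplicity k (detFormLex k m) m χ + Nat.card {s : ({i : MatIdx m // i ≠ i₀} →₀ ℕ) →₀ ℕ // IsVectorPartition (Finsupp.equivFunOnFinite.symm fun i : {i : MatIdx m // i ≠ i₀} => (-(χ i.1)).toNat) s ∧ m < s.degree} := by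
  classical
  have hm : m ≠ 0 := (Fin.pos (ofLex i₀).1).ne'
  -- notation
  set ιT : Type := {i : MatIdx m // i ≠ i₀}
  set α : ({i : MatIdx m // i ≠ i₀} →₀ ℕ) :=
    Finsupp.equivFunOnFinite.symm fun i : {i : MatIdx m // i ≠ i₀} => (-(χ i.1)).toNat with hα
  set R : Type _ := MvPolynomial ({i : MatIdx m // i ≠ i₀} × Fin m) k with hR
  set A : Matrix (MatIdx m) (MatIdx m) (MvPolynomial ({i : MatIdx m // i ≠ i₀} × Fin m) k) :=
    fun (l j : MatIdx m) => if (ofLex j).1 = (ofLex j).2 then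
      (if h : l = i₀ then (1 : MvPolynomial ({i : MatIdx m // i ≠ i₀} × Fin m) k)
        else X (⟨l, h⟩, (ofLex j).1)) else 0 with hA
  set γ : DegIdx (MatIdx m) m → ({i : MatIdx m // i ≠ i₀} →₀ ℕ) :=
    fun d => d.1.subtypeDomain (fun i => i ≠ i₀) with hγ
  set Θ : MvPolynomial ({i : MatIdx m // i ≠ i₀} →₀ ℕ) k →ₗ[k]
      MvPolynomial ({i : MatIdx m // i ≠ i₀} →₀ ℕ) k :=
    (basisMonomials ({i : MatIdx m // i ≠ i₀} →₀ ℕ) k).constr k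
      (fun s => (monomial (s.erase 0) (1 : k) : MvPolynomial ({i : MatIdx m // i ≠ i₀} →₀ ℕ) k))
    with hΘ
  set Φ : MvPolynomial (DegIdx (MatIdx m) m) k →ₗ[k] MvPolynomial ({i : MatIdx m // i ≠ i₀} →₀ ℕ) k :=
    Θ ∘ₗ (rename γ : MvPolynomial (DegIdx (MatIdx m) m) k →ₐ[k] _).toLinearMap with hΦ
  have hdegd : ∀ d : DegIdx (MatIdx m) m, d.1.degree = m := fun d => mem_degMonomials_iff.mp d.2
  have hγinj : Function.Injective γ := by
    intro d₁ d₂ h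
    apply Subtype.ext
    exact eq_of_subtypeDomain_eq_of_degree_eq i₀ h (by rw [hdegd d₁, hdegd d₂])
  -- the highest-weight space and the quotient map
  set V : Submodule k (MvPolynomial (DegIdx (MatIdx m) m) k) := highestWeightSpace (coordRep (MatIdx m) k m) χ
    with hV
  haveI : FiniteDimensional k V := finiteDimensional_highestWeightSpace_coordRep_holds hm χ
  let π : (coordRep (MatIdx m) k m).IntertwiningMap (orbitCoordRep (detFormLex k m) m) :=
    ⟨(Ideal.Quotient.mkₐ k (orbitVanishingIdeal (detFormLex k m) m)).toLinearMap,
      fun _ => LinearMap.ext fun _ => rfl⟩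
  have hmap := map_highestWeightSpace_eq_of_surjective π (Ideal.Quotient.mkₐ_surjective k _)
    (isSemisimpleRepresentation_coordRep m) χ
  have hr := LinearMap.finrank_range_add_finrank_ker (π.toLinearMap ∘ₗ V.subtype)
  rw [LinearMap.range_comp, Submodule.range_subtype] at hr
  set K₀ := LinearMap.ker (π.toLinearMap ∘ₗ V.subtype) with hK₀
  -- elements of the kernel: highest-weight vectors in the ideal
  have hKmem : ∀ x ∈ K₀, (x : MvPolynomial (DegIdx (MatIdx m) m) k) ∈ V ∧
      (x : MvPolynomial (DegIdx (MatIdx m) m) k) ∈ orbitVanishingIdeal (detFormLex k m) m := by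
    intro x hx
    refine ⟨x.2, ?_⟩
    rw [hK₀, LinearMap.mem_ker, LinearMap.comp_apply] at hx
    exact Ideal.Quotient.eq_zero_iff_mem.mp hx
  -- common degree of all monomials of weight vectors of weight `χ`
  set D : ℕ := (-χ.size).toNat / m with hDdef
  have hdegs : ∀ F ∈ V, ∀ s ∈ F.support, s.degree = D := by
    intro F hF s hs
    have hw := monWeight_eq_of_mem_weightSpace (highestWeightSpace_le_weightSpace _ _ hF) hs
    have h1 := size_monWeight (σ := MatIdx m) s
    rw [hw] at h1
    rw [hDdef, h1, neg_neg, Int.toNat_natCast, Nat.mul_div_cancel_left _ (Nat.pos_of_ne_zero hm)]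
  -- content of the monomials of the renamed polynomial
  have hw' : ∀ F ∈ V, ∀ s ∈ F.support, vpContent (s.mapDomain γ) = α := by
    intro F hF s hs
    have hw := monWeight_eq_of_mem_weightSpace (highestWeightSpace_le_weightSpace _ _ hF) hs
    have hc : vpContent (s.mapDomain γ) = s.sum (fun d e => e • γ d) := by
      unfold vpContent
      exact Finsupp.sum_mapDomain_index (fun _ => zero_smul _ _) (fun _ _ _ => add_smul _ _ _)
    rw [hc]
    ext i
    rw [hα, Finsupp.coe_equivFunOnFinite_symm, ← hw, monWeight_apply, neg_neg, Int.toNat_natCast,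
      Finsupp.sum, Finsupp.finsetSum_apply]
    refine Finset.sum_congr rfl fun d _ => ?_
    rw [Finsupp.smul_apply, smul_eq_mul]
    rfl
  -- `Φ` is injective on `V`
  have hΦinj : ∀ F ∈ V, Φ F = 0 → F = 0 := by
    intro F hF h0
    have hdeg' : ∀ s' ∈ (rename γ F).support, s'.degree = D := by
      intro s' hs'
      rw [support_rename_of_injective hγinj] at hs'
      obtain ⟨s, hs, rfl⟩ := Finset.mem_image.mp hs'
      rw [Finsupp.degree_mapDomain]
      exact hdegs F hF s hs
    have hren : rename γ F = 0 := by
      by_contra hne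
      obtain ⟨s', hs'⟩ := MvPolynomial.ne_zero_iff.mp hne
      have hs'' : s' ∈ (rename γ F).support := mem_support_iff.mpr hs'
      have hc := coeff_erase_constr_erase hdeg' s' hs''
      rw [hΦ, LinearMap.comp_apply, AlgHom.toLinearMap_apply] at h0
      rw [h0, coeff_zero] at hc
      exact hs' hc.symm
    exact rename_injective γ hγinj (by rw [hren, map_zero])
  -- the image `W` of the kernel
  set K₁ : Submodule k (MvPolynomial (DegIdx (MatIdx m) m) k) := K₀.map V.subtype with hK₁
  set W : Submodule k (MvPolynomial ({i : MatIdx m // i ≠ i₀} →₀ ℕ) k) := K₁.map Φ with hW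
  have hK₁V : ∀ F ∈ K₁, F ∈ V ∧ F ∈ orbitVanishingIdeal (detFormLex k m) m := by
    intro F hF
    rw [hK₁, Submodule.mem_map] at hF
    obtain ⟨x, hx, rfl⟩ := hF
    exact hKmem x hx
  have hfinK : Module.finrank k K₀ = Module.finrank k W := by
    have h1 : Module.finrank k K₁ = Module.finrank k K₀ := by
      rw [hK₁]
      exact LinearEquiv.finrank_eq (Submodule.equivMapOfInjective _ (Submodule.injective_subtype V) K₀).symm
    have h2 : Module.finrank k W = Module.finrank k K₁ := by
      have hinj : Function.Injective (Φ.domRestrict K₁) := by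
        intro x y hxy
        apply Subtype.ext
        have h := hΦinj (x.1 - y.1) (V.sub_mem (hK₁V _ x.2).1 (hK₁V _ y.2).1)
          (by rw [map_sub]; exact sub_eq_zero.mpr hxy)
        exact sub_eq_zero.mp h
      rw [hW, ← LinearMap.range_domRestrict]
      exact LinearMap.finrank_range_of_inj hinj
    rw [← h1, ← h2]
  -- apply the multisymmetric rank bound to `W`
  have hWle : Module.finrank k W ≤ Nat.card {s : ({i : MatIdx m // i ≠ i₀} →₀ ℕ) →₀ ℕ //
      IsVectorPartition α s ∧ m < s.degree} := by
    refine finrank_le_card_of_aeval_elemMultisymm_eq_zero {i : MatIdx m // i ≠ i₀} m α W ?_ ?_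
    · -- supports are vector partitions of `α`
      intro Q hQ s' hs'
      rw [hW, Submodule.mem_map] at hQ
      obtain ⟨F, hF, rfl⟩ := hQ
      obtain ⟨hFV, -⟩ := hK₁V F hF
      -- monomials of `Φ F` are `(s.mapDomain γ).erase 0`
      have hΦF : Φ F = ∑ s ∈ F.support, monomial ((s.mapDomain γ).erase 0) (coeff s F) := by
        rw [hΦ, LinearMap.comp_apply, AlgHom.toLinearMap_apply]
        conv_lhs => rw [← support_sum_monomial_coeff F, map_sum, map_sum]
        refine Finset.sum_congr rfl fun s _ => ?_
        rw [rename_monomial, hΘ, constr_erase_monomial]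
      rw [hΦF] at hs'
      obtain ⟨s, hs, hss⟩ := Finset.mem_biUnion.mp (support_sum hs')
      have hs'eq : s' = (s.mapDomain γ).erase 0 := by
        have := support_monomial_subset hss
        rwa [Finset.mem_singleton] at this
      subst hs'eq
      refine ⟨fun β hβ => ?_, ?_⟩
      · rw [Finsupp.support_erase] at hβ
        exact Finset.ne_of_mem_erase hβ
      · rw [vpContent_erase_zero]
        exact hw' F hFV s hs
    · -- `W` is killed by the evaluation at the elementary multisymmetric polynomials
      intro Q hQ
      rw [hW, Submodule.mem_map] at hQ
      obtain ⟨F, hF, rfl⟩ := hQ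
      obtain ⟨-, hFI⟩ := hK₁V F hF
      rw [hΦ, LinearMap.comp_apply, AlgHom.toLinearMap_apply, aeval_elemMultisymm_constr_erase,
        aeval_rename]
      have hfun : (elemMultisymm (k := k) {i : MatIdx m // i ≠ i₀} m) ∘ γ =
          fun d : DegIdx (MatIdx m) m => coeff d.1 (linSubst (MatIdx m) R A
            (map (algebraMap k R) (detFormLex k m))) :=
        funext fun d => by
          rw [MvPolynomial.algebraMap_eq]
          exact (coeff_linSubst_diagPencil_detFormLex i₀ d.1 (hdegd d)).symm
      rw [hfun, ← aeval_genericOrbitMap_matrix]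
      have h0 : genericOrbitMap (detFormLex k m) m F = 0 := by
        rw [orbitVanishingIdeal_eq_ker_genericOrbitMap] at hFI
        exact RingHom.mem_ker.mp hFI
      rw [h0, map_zero]
  -- assemble
  have hfinV : Module.finrank k V = plethysmCoeff k (MatIdx m) m χ := rfl
  have hfinO : Module.finrank k (V.map π.toLinearMap) = orbitMultiplicity k (detFormLex k m) m χ := by
    rw [hmap]; rfl
  omega

/-- **Partition form**: for `λ ⊢ mδ`, `a_λ(δ[m]) ≤ K_m(λ*) + p_{> m}(λ̄)`, where `λ̄` is read as the body
content of `λ* = partitionWeightLex m λ` off the top letter (the letter carrying `-λ₁`) and `p_{> m}`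
counts its vector partitions with more than `m` parts.  (For `bodySize λ ≤ m` the count vanishes and
this is `noSmallBodyEquations`.) [new] -/
theorem plethysmCoeff_le_orbitMultiplicity_det_add_card (m δ : ℕ) [NeZero m] (lam : Nat.Partition (m * δ)) : plethysmCoeff ℂ (MatIdx m) m (partitionWeightLex m lam) ≤ orbitMultiplicity ℂ (detFormLex ℂ m) m (partitionWeightLex m lam) + Nat.card {s : ({i : MatIdx m // i ≠ matIdxEquiv m ⟨m * m - 1, Nat.sub_one_lt_of_lt (Nat.mul_pos (NeZero.pos m) (NeZero.pos m))⟩} →₀ ℕ) →₀ ℕ // IsVectorPartition (Finsupp.equivFunOnFinite.symm fun i : {i : MatIdx m // i ≠ matIdxEquiv m ⟨m * m - 1, Nat.sub_one_lt_of_lt (Nat.mul_pos (NeZero.pos m) (NeZero.pos m))⟩} => (-(partitionWeightLex m lam i.1)).toNat) s ∧ m < s.degree} :=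
  plethysmCoeff_le_orbitMultiplicity_detFormLex_add_card _ _

/-- **A valuative flip forces a nearly full permanent side.**  If at `(n, m)`, `n ≤ m`, an admissible
centre `(U, r)` flips at `λ ⊢ mδ` (`≤ m²` parts) — `dim T_U(λ) < mult_{λ*} ℂ[Δ_m(X₀₀^{m−n} per_n)]`, the
body of the route decl `ValuativeFlip` verbatim — then
`a_λ(δ[m]) < mult_{λ*} ℂ[Δ_m(X₀₀^{m−n} per_n)] + p_{> m}(λ̄)`: the padded permanent's multiplicity is within
the vector-partition count `p_{> m}(λ̄)` of the FULL plethysm coefficient (`K_m ≤ dim T_U` by the proved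
`ValuativeBound`, and `a_λ ≤ K_m + p_{> m}(λ̄)`).  At body `m + 1` the count is `1`, so a flip there needs
`mult_pp = a_λ` on the nose. [new] -/
theorem plethysmCoeff_lt_of_flip {n m : ℕ} [NeZero m] (U : Submodule ℂ (MatIdx m → ℂ)) (r δ : ℕ) (lam : Nat.Partition (m * δ)) (hU : ∀ u ∈ U, (Matrix.of fun a b : Fin m => u (toLex (a, b))).rank ≤ r) (hlam : lam.parts.card ≤ m * m) (hflip : (let χ : Weight (MatIdx m) := (Weight.dualOfPartition (m * m) lam).toMatIdx; let T : Submodule ℂ (MvPolynomial (MatIdx m × MatIdx m) ℂ) := MvPolynomial.homogeneousSubmodule (MatIdx m × MatIdx m) ℂ (m * δ) ⊓ ((MvPolynomial.vanishingIdeal ℂ {p : MatIdx m × MatIdx m → ℂ | ∀ j : MatIdx m, (fun i => p (j, i)) ∈ U}) ^ (δ * (m - r))).restrictScalars ℂ ⊓ (⨅ (M : Matrix (MatIdx m) (MatIdx m) ℂ) (_ : linSubst (MatIdx m) ℂ M (detFormLex ℂ m) = detFormLex ℂ m), LinearMap.ker ((MvPolynomial.aeval (R := ℂ) fun p : MatIdx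 m × MatIdx m => ∑ l : MatIdx m, M l p.2 • MvPolynomial.X (p.1, l)).toLinearMap - LinearMap.id (R := ℂ) (M := MvPolynomial (MatIdx m × MatIdx m) ℂ))) ⊓ (⨅ (g : Matrix.GeneralLinearGroup (MatIdx m) ℂ) (_ : IsUpperTriangular g), LinearMap.ker ((MvPolynomial.aeval (R := ℂ) fun p : MatIdx m × MatIdx m => ∑ l : MatIdx m, ((g⁻¹ : Matrix.GeneralLinearGroup (MatIdx m) ℂ) : Matrix (MatIdx m) (MatIdx m) ℂ) p.1 l • MvPolynomial.X (l, p.2)).toLinearMap - weightChar χ g • LinearMap.id (R := ℂ) (M := MvPolynomial (MatIdx m × MatIdx m) ℂ))); Module.finrank ℂ ↥T < orbitMultiplicity ℂ (paddedPerFormLex ℂ n m) m χ)) : plethysmCoeff ℂ (MatIdx m) m (partitionWeightLex m lam) < orbitMultiplicity ℂ (paddedPerFormLex ℂ n m) m (partitionWeightLex m lam) + Nat.card {s : ({i : MatIdx m // i ≠ matIdxEquiv m ⟨m * m - 1, Nat.sub_one_lt_of_lt (Nat.mul_pos (NeZero.pos m) (NeZero.pos m))⟩} →₀ ℕ) →₀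 ℕ // IsVectorPartition (Finsupp.equivFunOnFinite.symm fun i : {i : MatIdx m // i ≠ matIdxEquiv m ⟨m * m - 1, Nat.sub_one_lt_of_lt (Nat.mul_pos (NeZero.pos m) (NeZero.pos m))⟩} => (-(partitionWeightLex m lam i.1)).toNat) s ∧ m < s.degree} := by
  have h1 := plethysmCoeff_le_orbitMultiplicity_det_add_card m δ lam
  have h2 : orbitMultiplicity ℂ (detFormLex ℂ m) m (partitionWeightLex m lam) <
      orbitMultiplicity ℂ (paddedPerFormLex ℂ n m) m (partitionWeightLex m lam) :=
    lt_of_le_of_lt (Summit.ValiantsHypothesis.ValiantsHypothesis.Theorems.ValuativeBound.ValuativeBound_proof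
      m U r hU δ lam hlam) hflip
  omega

end

end Summit.ValiantsHypothesis.ValiantsHypothesis.Theorems.ValuativeFlip
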